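import Mathlib.Analysis.InnerProductSpace.PiL2
import Mathlib.LinearAlgebra.Determinant
import HarnessLib

/-!
# Axis alignment of equivariant fields — crux stmt-NavierStokesRegularity-1404
  (`QuantisedSymmetry.PolyhedralDssProfileExists`), line polyhedral_cell,
  stub stub_axisAlignment (N20)

Registered stub `stub_axisAlignment` (`--supports stmt-NavierStokesRegularity-1404`). Let `G` be a
group of linear isometries of `ℝ³ = EuclideanSpace ℝ (Fin 3)` of determinant `1` (rotations), let
`g ∈ G`, `g ≠ 1`, fix a nonzero vector `e` (`g e = e`: the line `ℝ e` is the rotation axis of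
`g`), and let `w : ℝ³ → ℝ³` be `G`-equivariant (`w (h x) = h (w x)` for `h ∈ G`). Then `w` is
PARALLEL TO THE AXIS ON THE AXIS: `w (r • e) ∈ ℝ e` for every `r : ℝ`.

Proof.
* Equivariance: `g (w (r • e)) = w (g (r • e)) = w (r • g e) = w (r • e)`, so `v := w (r • e)`
  is a fixed vector of `g`.
* Linear algebra (`axisAlignment_fixed_eq_smul`, Euler's rotation theorem in the form we need):
  a linear isometry `g` of `ℝ³` with `det g = 1`, `g ≠ 1`, fixing the unit vector `e`, fixes
  only the multiples of `e`. Indeed, if `g v = v` with `v ∉ ℝ e`, the component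
  `u := v - ⟪e, v⟫ e` is a nonzero fixed vector orthogonal to `e`; extend the orthonormal pair
  `(e, u/‖u‖)` to an orthonormal basis `(e, u/‖u‖, n)` of `ℝ³`
  (`Orthonormal.exists_orthonormalBasis_extension_of_card_eq`). Since `g` is an isometry
  fixing `e` and `u`, the unit vector `g n` is again orthogonal to `e` and `u`, hence
  `g n = a • n` with `|a| = 1`. If `a = 1` then `g` fixes a basis, so `g = 1`; if `a = -1` the
  matrix of `g` in this basis is `diag (1, 1, -1)`, so `det g = -1 ≠ 1` (`LinearMap.det_toMatrix`,
  `Matrix.det_diagonal`). Either way a contradiction.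

All ingredients are Mathlib (`OrthonormalBasis`, `LinearMap.toMatrix`, `LinearMap.det_toMatrix`);
the fixed-space algebra follows the pattern of the tree's `…StubSchurJet.lean` (p156249).
-/

noncomputable section

open Module
open scoped InnerProductSpace RealInnerProductSpace

-- the summit namespace `…NavierStokesRegularity.NavierStokesRegularity…` is the tree convention
set_option linter.dupNamespace false

namespace Summit.NavierStokesRegularity.NavierStokesRegularity.Theorems.PolyhedralDssProfileExists.PolyhedralCell

/-! ### Linear algebra: the fixed space of a rotation of `ℝ³` is its axis -/

/-- **Determinant of a map that is diagonal in a basis**: if `f (b j) = ε j • b j` for every basis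
vector, then `det f = ∏ j, ε j` (the matrix of `f` in `b` is `Matrix.diagonal ε`). [folklore] -/
theorem axisAlignment_det_of_diagonal {ι : Type*} [Fintype ι] [DecidableEq ι]
    (b : Basis ι ℝ (EuclideanSpace ℝ (Fin 3)))
    (f : EuclideanSpace ℝ (Fin 3) →ₗ[ℝ] EuclideanSpace ℝ (Fin 3)) (ε : ι → ℝ)
    (hf : ∀ j, f (b j) = ε j • b j) : LinearMap.det f = ∏ j, ε j := by
  have hM : LinearMap.toMatrix b b f = Matrix.diagonal ε := by
    ext i j
    rw [LinearMap.toMatrix_apply, hf j, map_smul, b.repr_self, Finsupp.smul_apply,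
      Finsupp.single_apply, Matrix.diagonal_apply, smul_eq_mul]
    by_cases hij : i = j
    · subst hij
      simp
    · simp [hij, Ne.symm hij]
  rw [← LinearMap.det_toMatrix b, hM, Matrix.det_diagonal]

/-- **An isometry of `ℝ³` fixing two vectors of an orthonormal basis is the identity or has
determinant `-1`.** The image `g (b 2)` of the third basis vector is a unit vector orthogonal to
`g (b 0) = b 0` and `g (b 1) = b 1`, hence `g (b 2) = a • b 2` with `|a| = 1`; `a = 1` means `g`
fixes a basis (`g = 1`), `a = -1` means the matrix of `g` is `diag (1, 1, -1)` (`det g = -1`).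
[folklore] -/
theorem axisAlignment_eq_one_or_det_eq_neg_one
    (b : OrthonormalBasis (Fin 3) ℝ (EuclideanSpace ℝ (Fin 3)))
    (g : EuclideanSpace ℝ (Fin 3) ≃ₗᵢ[ℝ] EuclideanSpace ℝ (Fin 3))
    (h0 : g (b 0) = b 0) (h1 : g (b 1) = b 1) :
    g = 1 ∨ LinearMap.det
      (g.toLinearEquiv : EuclideanSpace ℝ (Fin 3) →ₗ[ℝ] EuclideanSpace ℝ (Fin 3)) = -1 := by
  -- `g (b 2)` is orthogonal to `b 0` and `b 1`
  have h20 : ⟪b 0, g (b 2)⟫_ℝ = 0 := by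
    rw [← h0, LinearIsometryEquiv.inner_map_map]
    exact b.inner_eq_zero (by decide)
  have h21 : ⟪b 1, g (b 2)⟫_ℝ = 0 := by
    rw [← h1, LinearIsometryEquiv.inner_map_map]
    exact b.inner_eq_zero (by decide)
  -- hence a multiple of `b 2`, of modulus one
  have hg2 : g (b 2) = ⟪b 2, g (b 2)⟫_ℝ • b 2 := by
    have h := b.sum_repr' (g (b 2))
    rw [Fin.sum_univ_three, h20, h21, zero_smul, zero_smul, zero_add, zero_add] at h
    exact h.symm
  have ha : ⟪b 2, g (b 2)⟫_ℝ = 1 ∨ ⟪b 2, g (b 2)⟫_ℝ = -1 := by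
    have h : ‖g (b 2)‖ = 1 := by rw [LinearIsometryEquiv.norm_map, b.norm_eq_one]
    rw [hg2, norm_smul, b.norm_eq_one, mul_one, Real.norm_eq_abs] at h
    exact (abs_eq zero_le_one).1 h
  rcases ha with ha | ha
  · -- `g` fixes the basis `b`, hence is the identity
    left
    have hfix : ∀ i, g (b i) = b i := by
      intro i
      fin_cases i
      · exact h0
      · exact h1
      · rw [ha, one_smul] at hg2
        exact hg2
    have hlin : (g.toLinearEquiv : EuclideanSpace ℝ (Fin 3) →ₗ[ℝ] EuclideanSpace ℝ (Fin 3)) =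
        LinearMap.id :=
      b.toBasis.ext fun i => by simp [OrthonormalBasis.coe_toBasis, hfix i]
    refine LinearIsometryEquiv.ext fun x => ?_
    have hx := LinearMap.congr_fun hlin x
    simpa using hx
  · -- the matrix of `g` in `b` is `diag (1, 1, -1)`
    right
    rw [axisAlignment_det_of_diagonal b.toBasis _ ![1, 1, -1] ?_]
    · simp [Fin.prod_univ_three]
    · intro j
      fin_cases j
      · simp [OrthonormalBasis.coe_toBasis, h0]
      · simp [OrthonormalBasis.coe_toBasis, h1]
      · rw [ha, neg_one_smul] at hg2
        simp [OrthonormalBasis.coe_toBasis, hg2]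

/-- **Fixed space of a rotation (unit axis).** If `g` is a linear isometry of `ℝ³` of determinant
`1`, `g ≠ 1`, fixing the unit vector `e`, then every fixed vector of `g` is a multiple of `e`:
`g v = v → v = ⟪e, v⟫ • e`. Otherwise `u := v - ⟪e, v⟫ • e ≠ 0` is fixed and orthogonal to `e`;
extending `(e, u/‖u‖)` to an orthonormal basis, `axisAlignment_eq_one_or_det_eq_neg_one` gives
`g = 1` or `det g = -1`. [folklore] -/
theorem axisAlignment_fixed_eq_smul_unit
    {g : EuclideanSpace ℝ (Fin 3) ≃ₗᵢ[ℝ] EuclideanSpace ℝ (Fin 3)}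
    (hdet : LinearMap.det
      (g.toLinearEquiv : EuclideanSpace ℝ (Fin 3) →ₗ[ℝ] EuclideanSpace ℝ (Fin 3)) = 1)
    (hg1 : g ≠ 1) {e : EuclideanSpace ℝ (Fin 3)} (he : ‖e‖ = 1) (hge : g e = e)
    {v : EuclideanSpace ℝ (Fin 3)} (hv : g v = v) : v = ⟪e, v⟫_ℝ • e := by
  by_contra hne
  have hee : ⟪e, e⟫_ℝ = 1 := by
    rw [real_inner_self_eq_norm_sq, he, one_pow]
  -- the component of `v` orthogonal to the axis: nonzero, fixed, orthogonal to `e`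
  have hu0 : v - ⟪e, v⟫_ℝ • e ≠ 0 := fun h => hne (sub_eq_zero.1 h)
  have hgu : g (v - ⟪e, v⟫_ℝ • e) = v - ⟪e, v⟫_ℝ • e := by
    rw [map_sub, LinearIsometryEquiv.map_smul, hv, hge]
  have heu : ⟪e, v - ⟪e, v⟫_ℝ • e⟫_ℝ = 0 := by
    rw [inner_sub_right, real_inner_smul_right, hee, mul_one, sub_self]
  -- normalise it
  set u : EuclideanSpace ℝ (Fin 3) := ‖v - ⟪e, v⟫_ℝ • e‖⁻¹ • (v - ⟪e, v⟫_ℝ • e) with hu_def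
  have hnorm : ‖v - ⟪e, v⟫_ℝ • e‖ ≠ 0 := norm_ne_zero_iff.2 hu0
  have hu1 : ‖u‖ = 1 := by
    rw [hu_def, norm_smul, norm_inv, norm_norm, inv_mul_cancel₀ hnorm]
  have hgu1 : g u = u := by
    rw [hu_def, LinearIsometryEquiv.map_smul, hgu]
  have heu1 : ⟪e, u⟫_ℝ = 0 := by
    rw [hu_def, real_inner_smul_right, heu, mul_zero]
  -- the orthonormal pair `(e, u)` extends to an orthonormal basis `(e, u, n)`
  have hon : Orthonormal ℝ (({0, 1} : Set (Fin 3)).restrict ![e, u, 0]) := by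
    rw [orthonormal_iff_ite]
    rintro ⟨i, hi⟩ ⟨j, hj⟩
    simp only [Set.mem_insert_iff, Set.mem_singleton_iff] at hi hj
    rcases hi with rfl | rfl <;> rcases hj with rfl | rfl <;>
      simp [Set.restrict_apply, he, hu1, heu1, real_inner_comm e u]
  have hcard : finrank ℝ (EuclideanSpace ℝ (Fin 3)) = Fintype.card (Fin 3) := by
    rw [finrank_euclideanSpace_fin, Fintype.card_fin]
  obtain ⟨b, hb⟩ := hon.exists_orthonormalBasis_extension_of_card_eq hcard
  have hb0 : b 0 = e := by simpa using hb 0 (by simp)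
  have hb1 : b 1 = u := by simpa using hb 1 (by simp)
  rcases axisAlignment_eq_one_or_det_eq_neg_one b g (by rw [hb0, hge]) (by rw [hb1, hgu1]) with
    h | h
  · exact hg1 h
  · rw [hdet] at h
    norm_num at h

/-- **Fixed space of a rotation of `ℝ³`** (Euler): a linear isometry `g` of `ℝ³` with
`det g = 1`, `g ≠ 1`, fixing the nonzero vector `e`, fixes exactly the axis `ℝ e` — every `v`
with `g v = v` is a multiple of `e`. (If `dim Fix(g) ≥ 2`, `g` acts on the invariant line
`Fix(g)ᗮ` by `±1`, and `det g = 1` forces `+1`, i.e. `g = 1`.) [folklore] -/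
theorem axisAlignment_fixed_eq_smul
    {g : EuclideanSpace ℝ (Fin 3) ≃ₗᵢ[ℝ] EuclideanSpace ℝ (Fin 3)}
    (hdet : LinearMap.det
      (g.toLinearEquiv : EuclideanSpace ℝ (Fin 3) →ₗ[ℝ] EuclideanSpace ℝ (Fin 3)) = 1)
    (hg1 : g ≠ 1) {e : EuclideanSpace ℝ (Fin 3)} (he : e ≠ 0) (hge : g e = e)
    {v : EuclideanSpace ℝ (Fin 3)} (hv : g v = v) : ∃ μ : ℝ, v = μ • e := by
  have hne : ‖e‖ ≠ 0 := norm_ne_zero_iff.2 he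
  have he1 : ‖‖e‖⁻¹ • e‖ = 1 := by
    rw [norm_smul, norm_inv, norm_norm, inv_mul_cancel₀ hne]
  have hge1 : g (‖e‖⁻¹ • e) = ‖e‖⁻¹ • e := by
    rw [LinearIsometryEquiv.map_smul, hge]
  refine ⟨⟪‖e‖⁻¹ • e, v⟫_ℝ * ‖e‖⁻¹, ?_⟩
  rw [← smul_smul]
  exact axisAlignment_fixed_eq_smul_unit hdet hg1 he1 hge1 hv

/-! ### The stub -/

/-- **Stub N20 (S/M): axis alignment.** Let `G` be a group of rotations of `ℝ³` (`det = 1`) and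
`g ∈ G`, `g ≠ 1`, fixing a nonzero vector `e` (so `ℝe` is the rotation axis of `g`). Then every
`G`-equivariant field `w` (`w(hx) = h w(x)`, `h ∈ G`) is PARALLEL TO THE AXIS ON THE AXIS:
`w(re) ∈ ℝe` for all `r`. Proof: `g (w (r e)) = w (g (r e)) = w (r e)`, so `w (r e)` lies in the
fixed space of `g`; a linear isometry of `ℝ³` with determinant `1` other than the identity fixing
`e ≠ 0` fixes exactly `ℝ e` (`axisAlignment_fixed_eq_smul`: if `dim Fix(g) ≥ 2`, `g` acts on the
invariant line `Fix(g)ᗮ` by `±1` and `det g = 1` forces `+1`, i.e. `g = 1`). Meaning for the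
crux: on each axis ray of `T/O/I` (through vertices, edge midpoints, face centres) the velocity of
a witness — and every other equivariant vector attached to it (vorticity, `ΔV`, `∂ₜV`, `∇p`) —
points along the ray: the "vortex star" structure of the route thesis, usable as a null test.
[folklore] -/
theorem stub_axisAlignment :
    ∀ (G : Subgroup (EuclideanSpace ℝ (Fin 3) ≃ₗᵢ[ℝ] EuclideanSpace ℝ (Fin 3))),
      (∀ g ∈ G, LinearMap.det (g.toLinearEquiv : EuclideanSpace ℝ (Fin 3) →ₗ[ℝ] EuclideanSpace ℝ (Fin 3)) = 1) →
      ∀ g ∈ G, g ≠ 1 → ∀ e : EuclideanSpace ℝ (Fin 3), e ≠ 0 → g e = e →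
      ∀ w : EuclideanSpace ℝ (Fin 3) → EuclideanSpace ℝ (Fin 3), (∀ h ∈ G, ∀ x, w (h x) = h (w x)) →
      ∀ r : ℝ, ∃ μ : ℝ, w (r • e) = μ • e := by
  intro G hdet g hg hg1 e he hge w hw r
  -- `w (r • e)` is a fixed vector of `g`
  have hfix : g (w (r • e)) = w (r • e) := by
    rw [← hw g hg, LinearIsometryEquiv.map_smul, hge]
  exact axisAlignment_fixed_eq_smul (hdet g hg) hg1 he hge hfix

end Summit.NavierStokesRegularity.NavierStokesRegularity.Theorems.PolyhedralDssProfileExists.PolyhedralCell
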